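import Summits.QuantumFields.YangMills.Theorems.PoincareLipschitzHierAlignWords
import HarnessLib

/-!
# Crux stmt-QuantumFields-19936 `HistoryTailL` — THE HIERARCHICAL ALIGNMENT, ONE LEVEL («ALIGN-STEP»):
# the block-axial gauge ROOTED IN A COARSE GAUGE versus the Bałaban AVERAGE as coarse variable

Cell `ym3-torus` (YM ladder rung R3 = continuum SU(2) Yang–Mills on the three-torus — a RUNG, NOT the Clay problem; not d = 4, not
infinite volume, not a mass gap), width seat `ym-ust-19936-w3` gen 12, `--supports stmt-QuantumFields-19936 --as helper`.  LEAD
★w1-19936 g7 word 01:07:50Z «ALIGN GO» (card v1.28∕v1.29 (c), ★w5 g10 LOCATE (R3)-COV §5 route (i)): the deep-regime a-priori sup-chart that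
the K2 supplier plan (h⋆ ∕ F5 ∕ F6) lacks beyond `j ≈ K∕2` is Bałaban's `k`-level axial gauge [Balaban1985Averaging] §C (64)–(68), whose
coarse variables are the AVERAGES `Ū` (the tree's `T4MultilevelCombGauge.multilevel_bound` is the same recursion for STRAIGHT transports on
`ℤ^d`, which the hierarchical windows do not control).  THIS FILE is the one-level step, `Params`-generic (bookkeeping in
✓`PoincareLipschitzHierAlignWords`):

* §3 ★★ `exists_rootedBlockAxialGauge` (any `[GaugeGroup G]`, any small-loop average `ℰ`): for a fine field `V : GaugeField P j G` and a
  COARSE gauge `h : GaugeTransf P (j+1) G` there is a fine gauge `u` with `u (emb y) = h y` (rooted in `h`) such that for EVERY fine bond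
  `b = ⟨x, ν⟩`, if the fine plaquettes based within coarse distance `2d` of `blockOf x` are `< a`, then
  `dist1 ((V^u) b) ≤ (((d+2)L)²∕4)·a + dist1 (corr ℰ V c) + dist1 (((avgFun ℰ V)^h) c)`, `c := ⟨blockOf x, ν⟩` — inside a block `V^u` is
  axial along the staircases from the centre (non-abelian Stokes on the closed word), across a block face the fine bond is compared with the
  straight transporter `axialAvg V c` (Stokes on the loop «staircase, bond, staircase back, `−c`») and then with `Ū(c) = corr·U(c)`;
* §4 ★★ `exists_rootedBlockAxialGauge_SU` (`SU(N)`, `ℰ = expMeanLogSU`): with the tree's local correction-factor bound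
  ✓`BlockAveragingPlaquetteBoundLocal.dist1_corr_le_local` the middle term is `≤ 6·(((d+2)L)²∕4)·a`, so
  `dist1 ((V^u) b) ≤ 2((d+2)L)²·a + dist1 (((avgFun V)^h) ⟨blockOf x, ν⟩)` under the guard `(((d+2)L)²∕4)·a < δ_N`.

Iterating §4 down the heights (top gauge free) is the companion «ALIGN-TOWER»; the `T3Family` letters (θ_i := θBal(K−i), Σθ summable
✓`PoincareLipschitzThresholdSums.sum_θBal_le`, the two-field corollary by bi-invariance) are «ALIGN-T3».  THEOREMS ONLY, def-free; nothing of
h⋆, F5∕F6, `BlockLipschitzL`, the stubs of any registered line, the crux `HistoryTailL` or a summit statement is proved here.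
-/

noncomputable section

open scoped BigOperators

namespace Summit.QuantumFields.YangMills.Theorems.PoincareLipschitzHierAlignStep

open Literature.MathematicalPhysics.QuantumFieldTheory.Balaban1983to89
open T4Continuum T4ReflectionCone BlockAveraging AveragingRT
open LatticeWordStokes LatticeWordStokesLocal BlockAveragingPlaquetteBoundLocal
open Summit.QuantumFields.YangMills.Theorems.PoincareLipschitzHierAlignWords

/-! ## §3 The rooted block-axial gauge and the one-level alignment (any gauge group, any small-loop average) -/

section Main

variable {P : Params} {j : ℕ} {G : Type*} [GaugeGroup G]

/-- `emb (y + e_ν) − L e_ν = emb y`: the backward straight walk of `L` steps from the next block centre returns to the centre. [folklore] -/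
theorem walkEnd_emb_shift_replicate_false (y : Site P (j + 1)) (ν : Fin P.d) :
    walkEnd (emb (y.shift ν)) (List.replicate P.L (ν, false)) = emb y := by
  have h1 : List.replicate P.L (ν, false) = wordRev (List.replicate P.L (ν, true)) := by
    rw [wordRev_replicate]; rfl
  rw [h1, ← walkEnd_replicate_L y ν, walkEnd_walkEnd_wordRev]

/-- The group identity behind the crossing-bond estimate: `h W h'⁻¹ = (h(WA⁻¹)h⁻¹)·(hC⁻¹h⁻¹)·(h(CA)h'⁻¹)`. [folklore] -/
theorem conj_split (hy hy' W A C : G) :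
    hy * W * hy'⁻¹ = (hy * (W * A⁻¹) * hy⁻¹) * (hy * C⁻¹ * hy⁻¹) * (hy * (C * A) * hy'⁻¹) := by group

/-- ★★ **THE ROOTED BLOCK-AXIAL GAUGE VERSUS THE AVERAGE, ONE LEVEL.**  For a fine configuration `V` of `T^{(j)}` and a gauge `h` of the
coarse torus `T^{(j+1)}` there is a fine gauge `u` — `u(x) = h(y)·V(Γ_{y,x})` along the staircase `Γ_{y,x}` from the centre `emb y` of the
block `B(y) ∋ x`, so that `V^u` is axial in every block and `u = h` at the centres — such that for every fine bond `b = ⟨x, x+e_ν⟩`: if every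
fine plaquette based in a block within coarse torus distance `2d` of `B(blockOf x)` is within `a` of `1`, then
`dist1 ((V^u) b) ≤ (((d+2)L)²∕4)·a + dist1 (corr ℰ V c) + dist1 (((avgFun ℰ V)^h) c)`, `c := ⟨blockOf x, ν⟩`:
inside the block the bond closes a short loop at the centre (lattice non-abelian Stokes); across the face of the block it is compared with the
straight transporter `U(c) = axialAvg V c` (Stokes on `Γ_{y,x} ∪ b ∪ (−Γ_{y′,x′}) ∪ (−c)`) and then with `Ū(c) = corr·U(c)` of
[Balaban1987RG1] (0.4) — the one-level step of the hierarchical axial gauge of [Balaban1985Averaging] §C (64)–(68) with the AVERAGE as the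
coarse variable. [cite: Balaban1985Averaging, (64)-(68) p.29; Balaban1987RG1, (0.3)-(0.4) pp.252-253] -/
theorem exists_rootedBlockAxialGauge (ℰ : LoopAverage G) (hj : j + 1 ≤ P.m + P.K) (V : GaugeField P j G) (h : GaugeTransf P (j + 1) G) :
    ∃ u : GaugeTransf P j G, (∀ y, u (emb y) = h y) ∧
      ∀ (b : PBond P j) (a : ℝ), 0 ≤ a →
        (∀ q : Plaq P j, Site.tdist (blockOf q.src) (blockOf b.src) ≤ 2 * P.d → dist1 (GaugeField.plaqHol V q) < a) →
        dist1 (GaugeField.gaugeAct u V b) ≤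
          ((((P.d + 2) * P.L : ℕ) : ℝ) ^ 2 / 4) * a + dist1 (corr ℰ V ⟨blockOf b.src, b.dir⟩) +
            dist1 (GaugeField.gaugeAct h (avgFun ℰ V) ⟨blockOf b.src, b.dir⟩) := by
  have hL1 : 1 < P.L := P.hL.2
  have hd : 1 ≤ P.d := P.hd
  have hLodd := AveragingRT.two_mul_half_add_one P
  -- the centred offsets, the staircases from the block centres and the gauge
  let n : Site P j → Fin P.d → ℤ := fun x κ => (((x κ).val % P.L : ℕ) : ℤ) - (((P.L - 1) / 2 : ℕ) : ℤ)
  let W : Site P j → List (Letter P.d) := fun x => stairWord 1 (n x)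
  let u : GaugeTransf P j G := fun x => h (blockOf x) * holAt V (walk (emb (blockOf x)) (W x))
  have hWend : ∀ x, walkEnd (emb (blockOf x)) (W x) = x := fun x => walkEnd_emb_blockOf_stairWord hj x 1
  have hWcount : ∀ x l, (W x).count l ≤ (P.L - 1) / 2 := fun x l => count_stairWord_le_half 1 (fun κ => ctrOff_bounds x κ) l
  have hWlen : ∀ x, (W x).length ≤ P.d * ((P.L - 1) / 2) := fun x =>
    length_stairWord_le 1 (n x) ((P.L - 1) / 2) fun ν => by
      have := ctrOff_bounds x ν
      show ((((x ν).val % P.L : ℕ) : ℤ) - (((P.L - 1) / 2 : ℕ) : ℤ)).natAbs ≤ (P.L - 1) / 2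
      omega
  refine ⟨u, fun y => ?_, fun b a ha hloc => ?_⟩
  · -- rooted in `h`: the staircase of a centre is empty
    show h (blockOf (emb y)) * holAt V (walk (emb (blockOf (emb y))) (stairWord 1 (n (emb y)))) = h y
    have hn0 : n (emb y) = fun _ => (0 : ℤ) := ctrOff_emb hj y
    rw [hn0, stairWord_zero, Site.blockOf_emb hj]
    simp [walk, holAt_nil]
  -- the bond `b = ⟨x, x + e_ν⟩`
  obtain ⟨x, ν⟩ := b
  have htgt : (⟨x, ν⟩ : PBond P j).tgt = x.shift ν := rfl
  simp only [htgt] at *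
  -- integers of absolute value `≤ 2L − 1` that vanish in `ℤ∕N_j` are zero
  have hsmallzero : ∀ z : ℤ, -((2 * P.L - 1 : ℕ) : ℤ) ≤ z ∧ z ≤ ((2 * P.L - 1 : ℕ) : ℤ) →
      ((z : ℤ) : ZMod (P.sitesPerDir j)) = 0 → z = 0 := by
    intro z hz e
    have hN : 2 * P.L - 1 < P.sitesPerDir j := by
      rw [P.sitesPerDir_eq_mul_succ hj]
      have h2 : 2 * P.L ≤ P.sitesPerDir (j + 1) * P.L := Nat.mul_le_mul_right _ (P.one_lt_sitesPerDir (j + 1))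
      omega
    rw [ZMod.intCast_zmod_eq_zero_iff_dvd] at e
    rcases e with ⟨k, hk⟩
    have hNz : (0 : ℤ) < (P.sitesPerDir j : ℤ) := by exact_mod_cast Nat.pos_of_ne_zero (P.sitesPerDir_ne_zero j)
    have hk0 : k = 0 := by
      by_contra hk0
      have h1 : (1 : ℤ) ≤ |k| := Int.one_le_abs hk0
      have h2 : |z| = (P.sitesPerDir j : ℤ) * |k| := by rw [hk, abs_mul, abs_of_pos hNz]
      have h3 : |z| ≤ ((2 * P.L - 1 : ℕ) : ℤ) := abs_le.mpr hz
      have h4 : ((2 * P.L - 1 : ℕ) : ℤ) < (P.sitesPerDir j : ℤ) := by exact_mod_cast hN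
      nlinarith
    rw [hk, hk0, mul_zero]
  -- the word `Γ_{y,x} ∪ b ∪ (−Γ_{y',x'})` and its holonomy
  have hWend' : walkEnd (emb (blockOf (x.shift ν))) (W (x.shift ν)) = x.shift ν := hWend _
  have hωend : walkEnd (emb (blockOf x)) (W x ++ [(ν, true)] ++ wordRev (W (x.shift ν))) = emb (blockOf (x.shift ν)) := by
    rw [walkEnd_append, walkEnd_append, hWend x]
    have e1 : walkEnd x [(ν, true)] = x.shift ν := rfl
    rw [e1]
    have e3 := walkEnd_walkEnd_wordRev (emb (blockOf (x.shift ν))) (W (x.shift ν))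
    rw [hWend'] at e3
    exact e3
  have hωhol : holAt V (walk (emb (blockOf x)) (W x ++ [(ν, true)] ++ wordRev (W (x.shift ν)))) =
      holAt V (walk (emb (blockOf x)) (W x)) * V ⟨x, ν⟩ * (holAt V (walk (emb (blockOf (x.shift ν))) (W (x.shift ν))))⁻¹ := by
    rw [walk_append, holAt_append, walk_append, holAt_append, walkEnd_append, hWend x]
    have e1 : walkEnd x [(ν, true)] = x.shift ν := rfl
    rw [e1]
    have e2 : holAt V (walk x [(ν, true)]) = V ⟨x, ν⟩ := by
      show holAt V [⟨⟨x, ν⟩, true⟩] = V ⟨x, ν⟩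
      rw [holAt_cons, holAt_nil]; simp
    rw [e2]
    have e3 := holAt_walk_wordRev V (emb (blockOf (x.shift ν))) (W (x.shift ν))
    rw [hWend'] at e3
    rw [e3, mul_assoc]
  have hgauge : GaugeField.gaugeAct u V ⟨x, ν⟩ =
      h (blockOf x) * holAt V (walk (emb (blockOf x)) (W x ++ [(ν, true)] ++ wordRev (W (x.shift ν)))) * (h (blockOf (x.shift ν)))⁻¹ := by
    rw [hωhol]
    show h (blockOf x) * holAt V (walk (emb (blockOf x)) (W x)) * V ⟨x, ν⟩ *
        (h (blockOf (x.shift ν)) * holAt V (walk (emb (blockOf (x.shift ν))) (W (x.shift ν))))⁻¹ = _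
    rw [mul_inv_rev]
    simp only [mul_assoc]
  -- letter budgets: every letter of `ω` (resp. `ω ∪ (−c)`) occurs at most `2L − 1` times
  have hcountω : ∀ l, (W x ++ [(ν, true)] ++ wordRev (W (x.shift ν))).count l ≤ 2 * P.L - 1 := by
    intro l
    rw [List.count_append, List.count_append]
    have h1 := hWcount x l
    have h2 : (wordRev (W (x.shift ν))).count l ≤ (P.L - 1) / 2 := by
      obtain ⟨κ, s⟩ := l; rw [T4StairWordPrefix.count_wordRev']; exact hWcount _ _
    have h3 : [(ν, true)].count l ≤ 1 := List.count_le_length.trans (by simp)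
    omega
  have hcountω' : ∀ l, (W x ++ [(ν, true)] ++ wordRev (W (x.shift ν)) ++ List.replicate P.L (ν, false)).count l ≤ 2 * P.L - 1 := by
    intro l
    rw [List.count_append, List.count_append, List.count_append, List.count_replicate]
    have h1 := hWcount x l
    have h2 : (wordRev (W (x.shift ν))).count l ≤ (P.L - 1) / 2 := by
      obtain ⟨κ, s⟩ := l; rw [T4StairWordPrefix.count_wordRev']; exact hWcount _ _
    by_cases hl : l = (ν, false)
    · subst hl
      have h3 : [(ν, true)].count (ν, false) = 0 := by simp
      rw [h3]
      split_ifs <;> omega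
    · have h3 : [(ν, true)].count l ≤ 1 := List.count_le_length.trans (by simp)
      have h4 : ((ν, false) == l) = false := by rw [beq_eq_false_iff_ne]; exact Ne.symm hl
      rw [h4]
      simp only [Bool.false_eq_true, ↓reduceIte, add_zero]
      omega
  -- locality: every site of the count box of these words lies in a block within coarse distance `2d` of `blockOf x`
  have hloc' : ∀ (w : List (Letter P.d)), (∀ l, w.count l ≤ 2 * P.L - 1) →
      ∀ v : List (Letter P.d), (∀ l, v.count l ≤ w.count l) →
        ∀ (a' b' : Fin P.d) (hab : a' < b'), dist1 (GaugeField.plaqHol V ⟨walkEnd (emb (blockOf x)) v, a', b', hab⟩) < a := by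
    intro w hw v hv a' b' hab
    exact hloc _ (tdist_blockOf_walkEnd_le hj (blockOf x) v fun κ => abs_netDisp_le_of_count_le hw hv κ)
  -- lengths
  have hlenω : (W x ++ [(ν, true)] ++ wordRev (W (x.shift ν))).length ≤ P.d * ((P.L - 1) / 2) + 1 + P.d * ((P.L - 1) / 2) := by
    rw [List.length_append, List.length_append]
    have h1 := hWlen x
    have h2 : (wordRev (W (x.shift ν))).length ≤ P.d * ((P.L - 1) / 2) := by
      rw [wordRev, List.length_reverse, List.length_map]; exact hWlen _
    simp only [List.length_singleton]
    omega
  have hlen_cast : ∀ {w : List (Letter P.d)}, w.length ≤ (P.d + 2) * P.L →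
      ((w.length : ℝ) ^ 2 / 4) * a ≤ ((((P.d + 2) * P.L : ℕ) : ℝ) ^ 2 / 4) * a := by
    intro w hw
    have hw' : (w.length : ℝ) ≤ (((P.d + 2) * P.L : ℕ) : ℝ) := by exact_mod_cast hw
    have h0 : (0 : ℝ) ≤ (w.length : ℝ) := Nat.cast_nonneg _
    exact mul_le_mul_of_nonneg_right (by nlinarith) ha
  have hdd : P.d * ((P.L - 1) / 2) + 1 + P.d * ((P.L - 1) / 2) + P.L ≤ (P.d + 2) * P.L := by
    have h1 : P.d * ((P.L - 1) / 2) + P.d * ((P.L - 1) / 2) + P.d = P.d * P.L := by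
      have : (P.L - 1) / 2 + (P.L - 1) / 2 + 1 = P.L := by omega
      calc P.d * ((P.L - 1) / 2) + P.d * ((P.L - 1) / 2) + P.d = P.d * ((P.L - 1) / 2 + (P.L - 1) / 2 + 1) := by ring
        _ = P.d * P.L := by rw [this]
    nlinarith
  have hcorr0 : 0 ≤ dist1 (corr ℰ V ⟨blockOf x, ν⟩) := GaugeGroup.dist1_nonneg _
  have havg0 : 0 ≤ dist1 (GaugeField.gaugeAct h (avgFun ℰ V) ⟨blockOf x, ν⟩) := GaugeGroup.dist1_nonneg _
  -- the two cases: `x + e_ν` in the same block, or in the next block in direction `ν`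
  have hcases : blockOf (x.shift ν) = blockOf x ∨ blockOf (x.shift ν) = (blockOf x).shift ν := by
    rw [B10StarCount.blockOf_shift hj x ν]
    split_ifs
    · right; rfl
    · left; rfl
  rcases hcases with hA | hB
  · -- CASE A: a bond inside the block `B(y)` — a closed loop at the centre
    have hclosed : ∀ κ, netDisp (W x ++ [(ν, true)] ++ wordRev (W (x.shift ν))) κ = 0 := by
      intro κ
      have e := congrFun hωend κ
      rw [walkEnd_apply, hA, add_eq_left] at e
      exact hsmallzero _ (abs_netDisp_le_of_count_le hcountω (fun l => le_rfl) κ) e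
    have hstokes := dist1_holAt_le_local V ha (emb (blockOf x)) _ (hloc' _ hcountω) hclosed
    rw [hgauge, hA, GaugeGroup.dist1_conj]
    calc dist1 (holAt V (walk (emb (blockOf x)) (W x ++ [(ν, true)] ++ wordRev (W (x.shift ν)))))
        ≤ (((W x ++ [(ν, true)] ++ wordRev (W (x.shift ν))).length : ℝ) ^ 2 / 4) * a := hstokes
      _ ≤ ((((P.d + 2) * P.L : ℕ) : ℝ) ^ 2 / 4) * a := hlen_cast (by omega)
      _ ≤ _ := by linarith
  · -- CASE B: a bond crossing into `B(y + e_ν)` — compare with the straight transporter, then with the average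
    have hctgt : (⟨blockOf x, ν⟩ : PBond P (j + 1)).tgt = blockOf (x.shift ν) := by rw [hB]; rfl
    have hclosed : ∀ κ, netDisp (W x ++ [(ν, true)] ++ wordRev (W (x.shift ν)) ++ List.replicate P.L (ν, false)) κ = 0 := by
      intro κ
      have e : walkEnd (emb (blockOf x)) (W x ++ [(ν, true)] ++ wordRev (W (x.shift ν)) ++ List.replicate P.L (ν, false)) =
          emb (blockOf x) := by
        rw [walkEnd_append, hωend, hB, walkEnd_emb_shift_replicate_false]
      have e' := congrFun e κ
      rw [walkEnd_apply, add_eq_left] at e'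
      exact hsmallzero _ (abs_netDisp_le_of_count_le hcountω' (fun l => le_rfl) κ) e'
    have hω'hol : holAt V (walk (emb (blockOf x)) (W x ++ [(ν, true)] ++ wordRev (W (x.shift ν)) ++ List.replicate P.L (ν, false))) =
        holAt V (walk (emb (blockOf x)) (W x ++ [(ν, true)] ++ wordRev (W (x.shift ν)))) * (axialAvg V ⟨blockOf x, ν⟩)⁻¹ := by
      rw [walk_append, holAt_append, hωend, ← hctgt, BlockAveragingEMLProp2.holAt_walk_replicate_false_tgt]
    have hstokes := dist1_holAt_le_local V ha (emb (blockOf x)) _ (hloc' _ hcountω') hclosed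
    have hlenω' : (W x ++ [(ν, true)] ++ wordRev (W (x.shift ν)) ++ List.replicate P.L (ν, false)).length ≤ (P.d + 2) * P.L := by
      rw [List.length_append, List.length_replicate]; omega
    -- split `h(y)·𝒰(ω)·h(y')⁻¹` through `U(c)` and `corr·U(c) = Ū(c)`
    set Hω := holAt V (walk (emb (blockOf x)) (W x ++ [(ν, true)] ++ wordRev (W (x.shift ν)))) with hHω
    set A := axialAvg V ⟨blockOf x, ν⟩ with hAdef
    set C := corr ℰ V ⟨blockOf x, ν⟩ with hCdef
    have havg : GaugeField.gaugeAct h (avgFun ℰ V) ⟨blockOf x, ν⟩ = h (blockOf x) * (C * A) * (h (blockOf (x.shift ν)))⁻¹ := by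
      show h (blockOf x) * (corr ℰ V ⟨blockOf x, ν⟩ * axialAvg V ⟨blockOf x, ν⟩) * (h (⟨blockOf x, ν⟩ : PBond P (j + 1)).tgt)⁻¹ = _
      rw [hctgt]
    have hsplit := conj_split (h (blockOf x)) (h (blockOf (x.shift ν))) Hω A C
    have h3 : dist1 (h (blockOf x) * (Hω * A⁻¹) * (h (blockOf x))⁻¹ * (h (blockOf x) * C⁻¹ * (h (blockOf x))⁻¹) *
        (h (blockOf x) * (C * A) * (h (blockOf (x.shift ν)))⁻¹)) ≤
        dist1 (Hω * A⁻¹) + dist1 C + dist1 (h (blockOf x) * (C * A) * (h (blockOf (x.shift ν)))⁻¹) := by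
      have t1 := GaugeGroup.dist1_mul_le (h (blockOf x) * (Hω * A⁻¹) * (h (blockOf x))⁻¹ * (h (blockOf x) * C⁻¹ * (h (blockOf x))⁻¹))
        (h (blockOf x) * (C * A) * (h (blockOf (x.shift ν)))⁻¹)
      have t2 := GaugeGroup.dist1_mul_le (h (blockOf x) * (Hω * A⁻¹) * (h (blockOf x))⁻¹) (h (blockOf x) * C⁻¹ * (h (blockOf x))⁻¹)
      rw [GaugeGroup.dist1_conj, GaugeGroup.dist1_conj, GaugeGroup.dist1_inv] at t2
      linarith
    rw [hgauge, hsplit, havg]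
    refine h3.trans ?_
    rw [← hω'hol]
    have := hstokes.trans (hlen_cast hlenω')
    linarith

end Main

/-! ## §4 `SU(N)` with the averaging of record: the correction factor discharged locally -/

section SUN

open ExpMeanLog
open scoped Matrix.Norms.L2Operator

variable {n : Type*} [Fintype n] [DecidableEq n] [Nonempty n] {P : Params} {j : ℕ}

/-- ★★ **ALIGN-STEP FOR `SU(N)` AND THE AVERAGING OF RECORD** (`blockAvg expMeanLogSU`, [Balaban1987RG1] (0.4)): for a fine `SU(N)`
configuration `V` and a coarse gauge `h` there is a fine gauge `u`, rooted in `h` (`u (emb y) = h y`), such that for every fine bond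
`b = ⟨x, x + e_ν⟩`: if the fine plaquettes based within coarse torus distance `2d` of `B(blockOf x)` are within `a` of `1` and
`(((d+2)L)²∕4)·a < δ_N`, then `dist1 ((V^u) b) ≤ 2((d+2)L)²·a + dist1 ((Ū^h) ⟨blockOf x, ν⟩)` with `Ū = avgFun expMeanLogSU V` — the fine
relative deviation is the local curvature plus the deviation of the AVERAGED coarse bond in the coarse gauge `h` (correction factor by
✓`BlockAveragingPlaquetteBoundLocal.dist1_corr_le_local`). [cite: Balaban1985Averaging, (64)-(68) p.29; Balaban1987RG1, (0.4) p.253] -/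
theorem exists_rootedBlockAxialGauge_SU (hj : j + 1 ≤ P.m + P.K) (V : GaugeField P j (Matrix.specialUnitaryGroup n ℂ))
    (h : GaugeTransf P (j + 1) (Matrix.specialUnitaryGroup n ℂ)) :
    ∃ u : GaugeTransf P j (Matrix.specialUnitaryGroup n ℂ), (∀ y, u (emb y) = h y) ∧
      ∀ (b : PBond P j) (a : ℝ), 0 ≤ a →
        (∀ q : Plaq P j, Site.tdist (blockOf q.src) (blockOf b.src) ≤ 2 * P.d → dist1 (GaugeField.plaqHol V q) < a) →
        ((((P.d + 2) * P.L : ℕ) : ℝ) ^ 2 / 4) * a < deltaSU n →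
        dist1 (GaugeField.gaugeAct u V b) ≤
          2 * ((((P.d + 2) * P.L : ℕ) : ℝ) ^ 2) * a +
            dist1 (GaugeField.gaugeAct h (avgFun (expMeanLogSU (n := n)) V) ⟨blockOf b.src, b.dir⟩) := by
  obtain ⟨u, hroot, hbound⟩ := exists_rootedBlockAxialGauge (expMeanLogSU (n := n)) hj V h
  refine ⟨u, hroot, fun b a ha hloc hguard => ?_⟩
  have h1 := hbound b a ha hloc
  -- the correction factor at `c = ⟨blockOf x, ν⟩`: the three blocks of `c` are within coarse distance `2d` of `blockOf x`
  have hcorr := dist1_corr_le_local (n := n) ha hj (U := V) ⟨blockOf b.src, b.dir⟩ (fun q hq => hloc q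
    (tdist_le_two_mul_d_of_three_blocks (blockOf b.src) (blockOf q.src) b.dir
      (by rcases hq with hq | hq | hq
          · left; exact hq
          · right; left; exact hq
          · right; right; exact hq))) hguard
  have ht : ((((P.d + 2) * P.L : ℕ) : ℝ) ^ 2 / 4) * a + 6 * (((((P.d + 2) * P.L : ℕ) : ℝ) ^ 2 / 4) * a) ≤
      2 * ((((P.d + 2) * P.L : ℕ) : ℝ) ^ 2) * a := by
    have h0 : 0 ≤ ((((P.d + 2) * P.L : ℕ) : ℝ) ^ 2) * a := by positivity
    nlinarith
  linarith

end SUN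

end Summit.QuantumFields.YangMills.Theorems.PoincareLipschitzHierAlignStep

end
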